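import Literature.Algebra.Homology.KunnethMap
import HarnessLib

/-!
# Descent of a bilinear cochain-level pairing to homology: `Hᵖ(C) ⊗ Hᵠ(D) ⟶ Hⁿ(E)`
# (Cartan–Eilenberg IV.6–IV.7 «the map α»; Weibel 3.6.3 / 6.7 (products); Godement II §6.6)

Layer `Literature/Algebra/Homology` (pure homological algebra over Mathlib; ONE definition = the canonical descended map,
its characterisation and uniqueness; no named facts, no instances).  For cochain complexes `C, D, E` of modules over a
commutative ring `R` (indexed by `ℤ`), degrees `p₀ + 1 = p`, `q₀ + 1 = q`, `n₀ + 1 = n`, and a PAIRING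

  `φ : Cᵖ ⊗ Dᵠ ⟶ Eⁿ`   (a morphism of `R`-modules out of Mathlib's monoidal tensor product)

such that
* (h1) `φ` maps cycles to cycles: `(ι ⊗ ι) ≫ φ ≫ d = 0`;
* (h2) `φ(dx ⊗ z)` is a boundary, NATURALLY: `(d ▷ Zᵠ) ≫ (Cᵖ ◁ ι) ≫ φ = ψ₁ ≫ d` for some `ψ₁ : Cᵖ⁰ ⊗ Zᵠ(D) ⟶ Eⁿ⁰`;
* (h3) `φ(z ⊗ dy)` is a boundary: `(Zᵖ ◁ d) ≫ (ι ▷ Dᵠ) ≫ φ = ψ₂ ≫ d` for some `ψ₂ : Zᵖ(C) ⊗ Dᵠ⁰ ⟶ Eⁿ⁰`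

(the shape of every cup/cross product satisfying a Leibniz rule `d(x ∪ y) = dx ∪ y ± x ∪ dy`: take `ψ₁ = ∪` and
`ψ₂ = ±∪`), the pairing DESCENDS to

  **`bilinearHomologyMap … : Hᵖ(C) ⊗ Hᵠ(D) ⟶ Hⁿ(E)`,  `[z] ⊗ [w] ↦ [φ(z ⊗ w)]`**

through the two cokernel presentations `Cᵖ⁰ ⊗ Zᵠ → Zᵖ ⊗ Zᵠ → Hᵖ ⊗ Zᵠ → 0` and `Hᵖ ⊗ Dᵠ⁰ → Hᵖ ⊗ Zᵠ → Hᵖ ⊗ Hᵠ → 0`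
(`⊗` is right exact in each variable) — exactly the construction of the Künneth component
`Algebra/Homology/KunnethMap.kunnethComponent` ([CartanEilenberg1956, IV.6]; [Weibel1994, Thm. 3.6.3]) with the
tensor-of-complexes replaced by an arbitrary pairing; characterised by
**`homologyπ_tensor_bilinearHomologyMap : (π ⊗ π) ≫ bilinearHomologyMap = (z ⊗ w ↦ [φ(z ⊗ w)])`** and unique with
this property (`hom_ext_homologyπ_tensor'`).  Consumers: the cup product on ordered Čech cohomology
(`Algebra/Homology/OrderedCechSystemCup*`, Leibniz rule `sysD_cup`) and the Künneth cross product of the F-11 packet.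

Everything here is a construction with a body or a proved lemma; no named fact.  Library only (cell hodgecm-mathlib,
FLOOR-0 P1 F-11 road A, jobs J3/J4-(iv)); HC_CM is proved only modulo the 7 printed citations until rung 0 closes, and
nothing here bears on it.

## References

* [CartanEilenberg1956] H. Cartan, S. Eilenberg, *Homological Algebra* (1956), IV.6 (the homomorphism `α`), IV.7, XI.4
  (products).
* [Weibel1994] C. A. Weibel, *An introduction to homological algebra* (1994), Thm. 3.6.3 (proof: the cross product on
  homology), 6.7.
* [Godement1958] R. Godement, *Topologie algébrique et théorie des faisceaux* (1958), II §6.6 (cup product on cohomology).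
-/

noncomputable section

set_option backward.isDefEq.respectTransparency false

open CategoryTheory CategoryTheory.Category CategoryTheory.Limits CategoryTheory.MonoidalCategory HomologicalComplex

universe u

namespace Literature.Algebra.Homology

variable {R : Type u} [CommRing R] (C D E : CochainComplex (ModuleCat.{u} R) ℤ)

/-! ### §1 The cokernel presentations of `Hᵖ ⊗ M` and `M ⊗ Hᵠ` with a free name for the previous degree -/

section Exactness

variable (M : ModuleCat.{u} R)

/-- **`Hᵖ(C) ⊗ M` is the cokernel of `Cᵖ⁰ ⊗ M → Zᵖ(C) ⊗ M`** for `p₀ + 1 = p`. [cite: Weibel1994, Thm. 3.6.3 (proof)] -/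
def isColimitHomologyTensor' {p₀ p : ℤ} (hp : p₀ + 1 = p) :
    IsColimit ((CokernelCofork.ofπ (C.homologyπ p) (C.toCycles_comp_homologyπ p₀ p)).map (tensorRight M)) :=
  haveI := preservesFiniteColimits_tensorRight M
  (CokernelCofork.ofπ (C.homologyπ p) (C.toCycles_comp_homologyπ p₀ p)).mapIsColimit
    (C.homologyIsCokernel p₀ p (by simp; omega)) (tensorRight M)

/-- **`M ⊗ Hᵠ(D)` is the cokernel of `M ⊗ Dᵠ⁰ → M ⊗ Zᵠ(D)`** for `q₀ + 1 = q`. [cite: Weibel1994, Thm. 3.6.3 (proof)] -/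
def isColimitTensorHomology' {q₀ q : ℤ} (hq : q₀ + 1 = q) :
    IsColimit ((CokernelCofork.ofπ (D.homologyπ q) (D.toCycles_comp_homologyπ q₀ q)).map (tensorLeft M)) :=
  haveI := preservesFiniteColimits_tensorLeft M
  (CokernelCofork.ofπ (D.homologyπ q) (D.toCycles_comp_homologyπ q₀ q)).mapIsColimit
    (D.homologyIsCokernel q₀ q (by simp; omega)) (tensorLeft M)

/-- **Uniqueness**: a map `Hᵖ(C) ⊗ Hᵠ(D) ⟶ A` is determined by its precomposition with `π ⊗ π`.
[cite: Weibel1994, Thm. 3.6.3 (proof)] -/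
theorem hom_ext_homologyπ_tensor' {p₀ p q₀ q : ℤ} (hp : p₀ + 1 = p) (hq : q₀ + 1 = q) {A : ModuleCat.{u} R}
    {f g : C.homology p ⊗ D.homology q ⟶ A}
    (hfg : (C.homologyπ p ⊗ₘ D.homologyπ q) ≫ f = (C.homologyπ p ⊗ₘ D.homologyπ q) ≫ g) : f = g := by
  apply Cofork.IsColimit.hom_ext (isColimitTensorHomology' D (C.homology p) hq)
  apply Cofork.IsColimit.hom_ext (isColimitHomologyTensor' C (D.cycles q) hp)
  rw [CokernelCofork.map_π, CokernelCofork.map_π]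
  change (C.homologyπ p ▷ D.cycles q) ≫ (C.homology p ◁ D.homologyπ q) ≫ f =
    (C.homologyπ p ▷ D.cycles q) ≫ (C.homology p ◁ D.homologyπ q) ≫ g
  rw [← tensorHom_def_assoc, ← tensorHom_def_assoc]
  exact hfg

end Exactness

/-! ### §2 The class `[φ(z ⊗ w)]` of a pairing of cycles -/

section Cycles

variable {p q n : ℤ} (φ : C.X p ⊗ D.X q ⟶ E.X n)

/-- `Zᵖ(C) ⊗ Zᵠ(D) ⟶ Eⁿ`, `z ⊗ w ↦ φ(z ⊗ w)`. [cite: CartanEilenberg1956, IV.6] -/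
def cyclesPairingι : C.cycles p ⊗ D.cycles q ⟶ E.X n :=
  (C.iCycles p ⊗ₘ D.iCycles q) ≫ φ

variable (h1 : (C.iCycles p ⊗ₘ D.iCycles q) ≫ φ ≫ E.d n (n + 1) = 0)

/-- `Zᵖ(C) ⊗ Zᵠ(D) ⟶ Zⁿ(E)` (by (h1), `φ(z ⊗ w)` is a cycle). [cite: CartanEilenberg1956, IV.6] -/
def cyclesPairingToCycles : C.cycles p ⊗ D.cycles q ⟶ E.cycles n :=
  E.liftCycles (cyclesPairingι C D E φ) (n + 1) (by simp) (by rw [cyclesPairingι, assoc, h1])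

/-- `cyclesPairingToCycles ≫ ι = cyclesPairingι`. [cite: CartanEilenberg1956, IV.6] -/
@[reassoc (attr := simp)]
theorem cyclesPairingToCycles_i : cyclesPairingToCycles C D E φ h1 ≫ E.iCycles n = cyclesPairingι C D E φ :=
  liftCycles_i _ _ _ _ _

/-- **`Zᵖ(C) ⊗ Zᵠ(D) ⟶ Hⁿ(E)`, `z ⊗ w ↦ [φ(z ⊗ w)]`.** [cite: CartanEilenberg1956, IV.6] [cite: Weibel1994, Thm. 3.6.3] -/
def cyclesPairingToHomology : C.cycles p ⊗ D.cycles q ⟶ E.homology n :=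
  cyclesPairingToCycles C D E φ h1 ≫ E.homologyπ n

/-- Precomposing `liftCycles` with a morphism. [folklore] -/
private theorem comp_liftCycles' {A B : ModuleCat.{u} R} (K : CochainComplex (ModuleCat.{u} R) ℤ) (g : A ⟶ B) {m : ℤ}
    (k : B ⟶ K.X m) (hk : k ≫ K.d m (m + 1) = 0) :
    g ≫ K.liftCycles k (m + 1) (by simp) hk =
      K.liftCycles (g ≫ k) (m + 1) (by simp) (by rw [assoc, hk, comp_zero]) := by
  rw [← cancel_mono (K.iCycles m), assoc, liftCycles_i, liftCycles_i]

/-- **`φ(dx ⊗ w)` is a boundary**: under (h2) `(d ▷ Zᵠ) ≫ (Cᵖ ◁ ι) ≫ φ = ψ₁ ≫ d` the map `z ⊗ w ↦ [φ(z ⊗ w)]` kills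
`Bᵖ(C) ⊗ Zᵠ(D)`: `(toCycles ▷ Zᵠ) ≫ cyclesPairingToHomology = 0`. [cite: Weibel1994, Thm. 3.6.3 (proof)] -/
theorem toCycles_whiskerRight_cyclesPairingToHomology {p₀ n₀ : ℤ} (hn : n₀ + 1 = n)
    (ψ₁ : C.X p₀ ⊗ D.cycles q ⟶ E.X n₀)
    (h2 : (C.d p₀ p ▷ D.cycles q) ≫ (C.X p ◁ D.iCycles q) ≫ φ = ψ₁ ≫ E.d n₀ n) :
    (C.toCycles p₀ p ▷ D.cycles q) ≫ cyclesPairingToHomology C D E φ h1 = 0 := by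
  have lhs : (C.toCycles p₀ p ▷ D.cycles q) ≫ cyclesPairingι C D E φ = ψ₁ ≫ E.d n₀ n := by
    rw [cyclesPairingι, ← tensorHom_id, tensorHom_comp_tensorHom_assoc, toCycles_i, id_comp, tensorHom_def_assoc,
      h2]
  rw [cyclesPairingToHomology, ← assoc, cyclesPairingToCycles, comp_liftCycles']
  subst hn
  exact E.liftCycles_homologyπ_eq_zero_of_boundary _ (n₀ + 1 + 1) (by simp) ψ₁ lhs

/-- **`φ(z ⊗ dy)` is a boundary**: under (h3) `(Zᵖ ◁ d) ≫ (ι ▷ Dᵠ) ≫ φ = ψ₂ ≫ d` the map `z ⊗ w ↦ [φ(z ⊗ w)]` kills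
`Zᵖ(C) ⊗ Bᵠ(D)`: `(Zᵖ ◁ toCycles) ≫ cyclesPairingToHomology = 0`. [cite: Weibel1994, Thm. 3.6.3 (proof)] -/
theorem whiskerLeft_toCycles_cyclesPairingToHomology {q₀ n₀ : ℤ} (hn : n₀ + 1 = n)
    (ψ₂ : C.cycles p ⊗ D.X q₀ ⟶ E.X n₀)
    (h3 : (C.cycles p ◁ D.d q₀ q) ≫ (C.iCycles p ▷ D.X q) ≫ φ = ψ₂ ≫ E.d n₀ n) :
    (C.cycles p ◁ D.toCycles q₀ q) ≫ cyclesPairingToHomology C D E φ h1 = 0 := by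
  have lhs : (C.cycles p ◁ D.toCycles q₀ q) ≫ cyclesPairingι C D E φ = ψ₂ ≫ E.d n₀ n := by
    rw [cyclesPairingι, ← id_tensorHom, tensorHom_comp_tensorHom_assoc, toCycles_i, id_comp, tensorHom_def'_assoc, h3]
  rw [cyclesPairingToHomology, ← assoc, cyclesPairingToCycles, comp_liftCycles']
  subst hn
  exact E.liftCycles_homologyπ_eq_zero_of_boundary _ (n₀ + 1 + 1) (by simp) ψ₂ lhs

end Cycles

/-! ### §3 The descent -/

section Descent

variable {p₀ p q₀ q n₀ n : ℤ} (hp : p₀ + 1 = p) (hq : q₀ + 1 = q) (hn : n₀ + 1 = n)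
  (φ : C.X p ⊗ D.X q ⟶ E.X n) (h1 : (C.iCycles p ⊗ₘ D.iCycles q) ≫ φ ≫ E.d n (n + 1) = 0)
  (ψ₁ : C.X p₀ ⊗ D.cycles q ⟶ E.X n₀) (h2 : (C.d p₀ p ▷ D.cycles q) ≫ (C.X p ◁ D.iCycles q) ≫ φ = ψ₁ ≫ E.d n₀ n)
  (ψ₂ : C.cycles p ⊗ D.X q₀ ⟶ E.X n₀) (h3 : (C.cycles p ◁ D.d q₀ q) ≫ (C.iCycles p ▷ D.X q) ≫ φ = ψ₂ ≫ E.d n₀ n)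

/-- First descent: `Hᵖ(C) ⊗ Zᵠ(D) ⟶ Hⁿ(E)`. [cite: Weibel1994, Thm. 3.6.3 (proof)] -/
def homologyTensorCyclesPairingDesc : C.homology p ⊗ D.cycles q ⟶ E.homology n :=
  Cofork.IsColimit.desc (isColimitHomologyTensor' C (D.cycles q) hp) (cyclesPairingToHomology C D E φ h1)
    (by
      rw [zero_comp]
      exact toCycles_whiskerRight_cyclesPairingToHomology C D E φ h1 hn ψ₁ h2)

/-- `(π ▷ Zᵠ) ≫ (first descent) = (z ⊗ w ↦ [φ(z ⊗ w)])`. [cite: Weibel1994, Thm. 3.6.3 (proof)] -/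
@[reassoc (attr := simp)]
theorem homologyπ_whiskerRight_homologyTensorCyclesPairingDesc :
    (C.homologyπ p ▷ D.cycles q) ≫ homologyTensorCyclesPairingDesc C D E hp hn φ h1 ψ₁ h2 =
      cyclesPairingToHomology C D E φ h1 :=
  Cofork.IsColimit.π_desc' (isColimitHomologyTensor' C (D.cycles q) hp) _ _

include ψ₂ h3 in
/-- The first descent still kills `Hᵖ(C) ⊗ Bᵠ(D)`. [cite: Weibel1994, Thm. 3.6.3 (proof)] -/
theorem whiskerLeft_toCycles_homologyTensorCyclesPairingDesc :
    (C.homology p ◁ D.toCycles q₀ q) ≫ homologyTensorCyclesPairingDesc C D E hp hn φ h1 ψ₁ h2 = 0 := by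
  apply Cofork.IsColimit.hom_ext (isColimitHomologyTensor' C (D.X q₀) hp)
  rw [CokernelCofork.map_π, comp_zero]
  change (C.homologyπ p ▷ D.X q₀) ≫ (C.homology p ◁ D.toCycles q₀ q) ≫
    homologyTensorCyclesPairingDesc C D E hp hn φ h1 ψ₁ h2 = 0
  rw [← whisker_exchange_assoc]
  change (C.cycles p ◁ D.toCycles q₀ q) ≫ (C.homologyπ p ▷ D.cycles q) ≫
    homologyTensorCyclesPairingDesc C D E hp hn φ h1 ψ₁ h2 = 0
  rw [homologyπ_whiskerRight_homologyTensorCyclesPairingDesc]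
  exact whiskerLeft_toCycles_cyclesPairingToHomology C D E φ h1 hn ψ₂ h3

include hq ψ₂ h3 in
/-- **The descended pairing `Hᵖ(C) ⊗ Hᵠ(D) ⟶ Hⁿ(E)`, `[z] ⊗ [w] ↦ [φ(z ⊗ w)]`** (second descent, through
`Hᵖ ⊗ Dᵠ⁰ → Hᵖ ⊗ Zᵠ → Hᵖ ⊗ Hᵠ → 0`). [cite: CartanEilenberg1956, IV.6] [cite: Weibel1994, Thm. 3.6.3] -/
def bilinearHomologyMap : C.homology p ⊗ D.homology q ⟶ E.homology n :=
  Cofork.IsColimit.desc (isColimitTensorHomology' D (C.homology p) hq)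
    (homologyTensorCyclesPairingDesc C D E hp hn φ h1 ψ₁ h2)
    (by
      rw [zero_comp]
      exact whiskerLeft_toCycles_homologyTensorCyclesPairingDesc C D E hp hn φ h1 ψ₁ h2 ψ₂ h3)

/-- `(Hᵖ ◁ π) ≫ bilinearHomologyMap = (first descent)`. [cite: Weibel1994, Thm. 3.6.3] -/
@[reassoc (attr := simp)]
theorem whiskerLeft_homologyπ_bilinearHomologyMap :
    (C.homology p ◁ D.homologyπ q) ≫ bilinearHomologyMap C D E hp hq hn φ h1 ψ₁ h2 ψ₂ h3 =
      homologyTensorCyclesPairingDesc C D E hp hn φ h1 ψ₁ h2 :=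
  Cofork.IsColimit.π_desc' (isColimitTensorHomology' D (C.homology p) hq) _ _

/-- **The defining property**: `(π ⊗ π) ≫ bilinearHomologyMap = (z ⊗ w ↦ [φ(z ⊗ w)])`.
[cite: CartanEilenberg1956, IV.6] [cite: Weibel1994, Thm. 3.6.3] -/
@[reassoc]
theorem homologyπ_tensor_bilinearHomologyMap :
    (C.homologyπ p ⊗ₘ D.homologyπ q) ≫ bilinearHomologyMap C D E hp hq hn φ h1 ψ₁ h2 ψ₂ h3 =
      cyclesPairingToHomology C D E φ h1 := by
  rw [tensorHom_def, assoc, whiskerLeft_homologyπ_bilinearHomologyMap,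
    homologyπ_whiskerRight_homologyTensorCyclesPairingDesc]

/-- **Uniqueness of the descended pairing**: any `g : Hᵖ ⊗ Hᵠ ⟶ Hⁿ` with `(π ⊗ π) ≫ g = (z ⊗ w ↦ [φ(z ⊗ w)])` IS
`bilinearHomologyMap`. [cite: Weibel1994, Thm. 3.6.3 (proof)] -/
theorem bilinearHomologyMap_unique {g : C.homology p ⊗ D.homology q ⟶ E.homology n}
    (hg : (C.homologyπ p ⊗ₘ D.homologyπ q) ≫ g = cyclesPairingToHomology C D E φ h1) :
    g = bilinearHomologyMap C D E hp hq hn φ h1 ψ₁ h2 ψ₂ h3 :=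
  hom_ext_homologyπ_tensor' C D hp hq (by rw [hg, homologyπ_tensor_bilinearHomologyMap])

/-- **Element form of the defining property**: for cycles `z ∈ Zᵖ(C)`, `w ∈ Zᵠ(D)`,
`bilinearHomologyMap (π z ⊗ₜ π w) = π (⟨φ(ι z ⊗ₜ ι w)⟩)`, the class of the cycle `φ(z ⊗ w)`.
[cite: CartanEilenberg1956, IV.6] -/
theorem bilinearHomologyMap_tmul (z : C.cycles p) (w : D.cycles q) :
    (bilinearHomologyMap C D E hp hq hn φ h1 ψ₁ h2 ψ₂ h3).hom (C.homologyπ p z ⊗ₜ D.homologyπ q w) =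
      (E.homologyπ n).hom ((cyclesPairingToCycles C D E φ h1).hom (z ⊗ₜ w)) := by
  have h := homologyπ_tensor_bilinearHomologyMap C D E hp hq hn φ h1 ψ₁ h2 ψ₂ h3
  have h' := congrArg (fun f => f.hom (z ⊗ₜ w)) h
  simpa [cyclesPairingToHomology, ModuleCat.MonoidalCategory.tensorHom_tmul] using h'

/-- **Surjectivity criterion for the descended pairing**: if every class of `Hⁿ(E)` is the class `[φ(t)]` of the
pairing of some tensor `t ∈ Zᵖ(C) ⊗ Zᵠ(D)` of cycles (in the applications: «every `n`-cocycle is, up to a coboundary,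
a sum `Σ φ(zᵢ ⊗ wᵢ)` of pairings of cocycles»), then `bilinearHomologyMap : Hᵖ(C) ⊗ Hᵠ(D) ⟶ Hⁿ(E)` is onto.
[cite: Weibel1994, Thm. 3.6.3] -/
theorem bilinearHomologyMap_surjective_of
    (H : ∀ y : E.homology n, ∃ t : (C.cycles p ⊗ D.cycles q : ModuleCat.{u} R),
      y = (cyclesPairingToHomology C D E φ h1).hom t) :
    Function.Surjective (bilinearHomologyMap C D E hp hq hn φ h1 ψ₁ h2 ψ₂ h3).hom := by
  intro y
  obtain ⟨t, rfl⟩ := H y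
  refine ⟨(C.homologyπ p ⊗ₘ D.homologyπ q).hom t, ?_⟩
  have h := homologyπ_tensor_bilinearHomologyMap C D E hp hq hn φ h1 ψ₁ h2 ψ₂ h3
  exact (congrArg (fun f => f.hom t) h :)

/-- In a cochain complex of modules, a cycle with zero class is a boundary: `π z = 0 ⇒ z = toCycles x`
(`Hʲ` is the cokernel of `Cⁱ → Zʲ`, read elementwise). [cite: Weibel1994, Thm. 3.6.3 (proof)] -/
theorem exists_toCycles_of_homologyπ_eq_zero (K : CochainComplex (ModuleCat.{u} R) ℤ) {i j : ℤ} (hij : i + 1 = j)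
    (z : K.cycles j) (hz : (K.homologyπ j).hom z = 0) : ∃ x : K.X i, (K.toCycles i j).hom x = z := by
  let S : ShortComplex (ModuleCat.{u} R) := ShortComplex.mk (K.toCycles i j) (K.homologyπ j)
    (K.toCycles_comp_homologyπ i j)
  have hS : S.Exact := S.exact_of_g_is_cokernel (K.homologyIsCokernel i j (by simp; omega))
  exact (S.moduleCat_exact_iff.1 hS) z hz

/-- **Cocycle representation from surjectivity**: if the descended pairing `Hᵖ ⊗ Hᵠ ⟶ Hⁿ` is onto, then every
`n`-cycle `e` of `E` is `φ(t) + d x` for some tensor `t ∈ Zᵖ(C) ⊗ Zᵠ(D)` of cycles and some `x ∈ Eⁿ⁰` — the converse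
bookkeeping of `bilinearHomologyMap_surjective_of` («every class is a sum of products» ⇒ «every cocycle is a sum of
products of cocycles up to a coboundary»). [cite: Weibel1994, Thm. 3.6.3] -/
theorem exists_eq_pairing_add_toCycles_of_surjective
    (hsurj : Function.Surjective (bilinearHomologyMap C D E hp hq hn φ h1 ψ₁ h2 ψ₂ h3).hom) (e : E.cycles n) :
    ∃ (t : (C.cycles p ⊗ D.cycles q : ModuleCat.{u} R)) (x : E.X n₀),
      e = (cyclesPairingToCycles C D E φ h1).hom t + (E.toCycles n₀ n).hom x := by
  obtain ⟨u, hu⟩ := hsurj ((E.homologyπ n).hom e)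
  -- `π ⊗ π` is onto
  have hππ : Function.Surjective (C.homologyπ p ⊗ₘ D.homologyπ q).hom := by
    change Function.Surjective (TensorProduct.map (C.homologyπ p).hom (D.homologyπ q).hom)
    exact TensorProduct.map_surjective ((ModuleCat.epi_iff_surjective _).1 inferInstance)
      ((ModuleCat.epi_iff_surjective _).1 inferInstance)
  obtain ⟨t, rfl⟩ := hππ u
  have h := congrArg (fun f => f.hom t) (homologyπ_tensor_bilinearHomologyMap C D E hp hq hn φ h1 ψ₁ h2 ψ₂ h3)
  simp only [ModuleCat.hom_comp, LinearMap.comp_apply] at h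
  rw [h] at hu
  -- `π (e - φ t) = 0`
  have hz : (E.homologyπ n).hom (e - (cyclesPairingToCycles C D E φ h1).hom t) = 0 := by
    rw [map_sub, sub_eq_zero, ← hu]
    rfl
  obtain ⟨x, hx⟩ := exists_toCycles_of_homologyπ_eq_zero E hn _ hz
  exact ⟨t, x, by rw [hx, add_sub_cancel]⟩

end Descent

end Literature.Algebra.Homology

end
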